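import Literature.Geometry.Lorentzian.KerrBoyerLindquistLeafMap
import Literature.Analysis.Calculus.LocalAzimuth
import HarnessLib

/-!
# The Boyer–Lindquist slice of Kerr as a map from quasi-isotropic Cartesian coordinates, II:
# the differential of the leaf map and its induced metric off the axis

Support file (all results proved; the definitions are explicit closed-form expressions, no named
facts), step 4 of the statement that the Boyer–Lindquist slice of Kerr is an exact Kerr leaf
with Dafermos–Rodnianski-admissible asymptotics (`KerrBoyerLindquistSliceIngoing`,
`…QuasiIsotropic`, `…LeafMap`).

About an off-axis point `x` the leaf map `Kerr.BL.leafRep M a b` (`…LeafMap.lean`) factors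
through Kerr's ingoing coordinates: with the local azimuth `Φ_x` of `LocalAzimuth.lean`,

  `leafRep = Ψ ∘ σ` near `x`,  `σ(y) = (F(R(‖y‖)), R(‖y‖), y₃/‖y‖, Φ_x(y) + G(R(‖y‖)))`

(`Kerr.BL.coordSection`, `chartFun_coordSection_eventuallyEq`; `Ψ = Kerr.Ingoing.chartFun`), and
the differential of `σ` at `x` is the Boyer–Lindquist lift of the slice differentials of step 2,
`dσ_x v = blLift(dR v, dμ v, dφ v)` with `dR = (q/ρ)(⟪x, ·⟫/ρ)` (`hasFDerivAt_coordSection`,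
`coordSectionDeriv_apply`). Hence (`hasFDerivAt_leafRep`) **`d(leafRep)_x = J_{σ x} ∘ dσ_x`**
(`J` the Jacobian of `Ψ`, `Kerr.Ingoing.hasFDerivAt_chartFun`), and by the pull-back identity
`g_{Ψ u}(J v, J w) = g^{in}_u(v, w)` (`Kerr.Ingoing.kerrBilin_jac`) together with
`bilin_blLift_quasiIsotropic` (step 2) the **induced metric of the leaf map at an off-axis point
is the closed form `blHRep`** (`bilin_fderiv_leafRep`):

  `g_{leafRep x}(d leafRep v, d leafRep w) = (Σ/ρ²)⟪v, w⟫ + (a²(Σ + 2MR)/Σ) ϖ(v)ϖ(w)`.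

(The axis is handled in the sequel by continuity.) References: Brandt–Seidel, Phys. Rev. D 54
(1996) 1403, §II; Visser arXiv:0706.0622, §4–§5; Boyer–Lindquist 1967.
-/

noncomputable section

open Bundle TopologicalSpace Set Module Real Filter
open scoped InnerProductSpace Topology ContDiff

namespace Literature.Geometry.Lorentzian

namespace Kerr.BL

open Kerr.Ingoing Literature.Analysis.Calculus

/-! ### Spherical bookkeeping at off-axis points -/

/-- Off the axis a point is nonzero. [folklore] -/
theorem ne_zero_of_offAxis {y : E3} (hy : y 0 ≠ 0 ∨ y 1 ≠ 0) : y ≠ 0 := by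
  rintro rfl
  simp at hy

/-- `x₁² + x₂² ≠ 0` off the axis. [folklore] -/
theorem sq_add_sq_ne_zero_of_offAxis {y : E3} (hy : y 0 ≠ 0 ∨ y 1 ≠ 0) : y 0 ^ 2 + y 1 ^ 2 ≠ 0 := by
  rcases hy with h | h
  · have : 0 < y 0 ^ 2 := by positivity
    nlinarith [sq_nonneg (y 1)]
  · have : 0 < y 1 ^ 2 := by positivity
    nlinarith [sq_nonneg (y 0)]

/-- Off the axis `−1 < y₃/‖y‖ < 1`. [folklore] -/
theorem div_norm_mem_Ioo {y : E3} (hy : y 0 ≠ 0 ∨ y 1 ≠ 0) : -1 < y 2 / ‖y‖ ∧ y 2 / ‖y‖ < 1 := by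
  have hn : ‖y‖ ^ 2 = y 0 ^ 2 + y 1 ^ 2 + y 2 ^ 2 := E3.norm_sq y
  have hP : 0 < y 0 ^ 2 + y 1 ^ 2 := by
    have := sq_add_sq_ne_zero_of_offAxis hy
    positivity
  have hρ : 0 < ‖y‖ := norm_pos_iff.2 (ne_zero_of_offAxis hy)
  have h2 : y 2 ^ 2 < ‖y‖ ^ 2 := by rw [hn]; linarith
  have habs : |y 2| < ‖y‖ := abs_lt_of_sq_lt_sq' h2 hρ.le |>.2 |> fun h ↦ by
    exact abs_lt.2 ⟨(abs_lt_of_sq_lt_sq' h2 hρ.le).1, h⟩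
  rw [abs_lt] at habs
  constructor
  · rw [lt_div_iff₀ hρ]; linarith
  · rw [div_lt_one hρ]; linarith

/-- **The point with spherical data `(‖y‖, arccos(y₃/‖y‖), φ)` is `y`** whenever `φ` is an
azimuth of `y` (`cos φ = y₁/√(y₁²+y₂²)`, `sin φ = y₂/√(y₁²+y₂²)`):
`y = Y_0(‖y‖, arccos(y₃/‖y‖), φ) = ‖y‖ n̂` (`sin arccos t = √(1 − t²) = √(y₁²+y₂²)/‖y‖`). [folklore] -/
theorem kerrStar_norm_arccos_eq {y : E3} (hy : y 0 ≠ 0 ∨ y 1 ≠ 0) {φ : ℝ}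
    (hc : Real.cos φ = y 0 / Real.sqrt (y 0 ^ 2 + y 1 ^ 2))
    (hs : Real.sin φ = y 1 / Real.sqrt (y 0 ^ 2 + y 1 ^ 2)) :
    kerrStar 0 ‖y‖ (arccos (y 2 / ‖y‖)) φ = y := by
  have hn : ‖y‖ ^ 2 = y 0 ^ 2 + y 1 ^ 2 + y 2 ^ 2 := E3.norm_sq y
  have hρ : 0 < ‖y‖ := norm_pos_iff.2 (ne_zero_of_offAxis hy)
  have hP : 0 < y 0 ^ 2 + y 1 ^ 2 := by
    have := sq_add_sq_ne_zero_of_offAxis hy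
    positivity
  set r₂ := Real.sqrt (y 0 ^ 2 + y 1 ^ 2) with hr₂
  have hr₂pos : 0 < r₂ := Real.sqrt_pos.2 hP
  have hr₂sq : r₂ ^ 2 = y 0 ^ 2 + y 1 ^ 2 := Real.sq_sqrt hP.le
  obtain ⟨hlo, hhi⟩ := div_norm_mem_Ioo hy
  have hcosθ : Real.cos (arccos (y 2 / ‖y‖)) = y 2 / ‖y‖ := cos_arccos hlo.le hhi.le
  have hsinθ : Real.sin (arccos (y 2 / ‖y‖)) = r₂ / ‖y‖ := by
    rw [sin_arccos]
    have h1 : 1 - (y 2 / ‖y‖) ^ 2 = (r₂ / ‖y‖) ^ 2 := by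
      rw [div_pow, div_pow, hr₂sq]
      field_simp
      linarith [hn]
    rw [h1, Real.sqrt_sq (by positivity)]
  ext i
  fin_cases i
  · show kerrStar 0 ‖y‖ (arccos (y 2 / ‖y‖)) φ 0 = y 0
    rw [kerrStar_apply_zero, hc, hsinθ]
    field_simp
    ring
  · show kerrStar 0 ‖y‖ (arccos (y 2 / ‖y‖)) φ 1 = y 1
    rw [kerrStar_apply_one, hs, hc, hsinθ]
    field_simp
    ring
  · show kerrStar 0 ‖y‖ (arccos (y 2 / ‖y‖)) φ 2 = y 2
    rw [kerrStar_apply_two, hcosθ]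
    field_simp

/-- With the local azimuth of `LocalAzimuth.lean`: `y = Y_0(‖y‖, arccos(y₃/‖y‖), Φ_x(y))` for all
`y` off the axis with `c̄(x) z(y)` in the slit plane (in particular eventually near `x`). [folklore] -/
theorem kerrStar_norm_arccos_localAzimuth {x y : E3} (hx : x 0 ≠ 0 ∨ x 1 ≠ 0)
    (hy : y 0 ≠ 0 ∨ y 1 ≠ 0) :
    kerrStar 0 ‖y‖ (arccos (y 2 / ‖y‖)) (localAzimuth x y) = y :=
  kerrStar_norm_arccos_eq hy ((cos_localAzimuth hx hy).trans (by rw [norm_zCLM]))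
    ((sin_localAzimuth hx hy).trans (by rw [norm_zCLM]))

/-! ### The coordinate section and its differential -/

variable (M a b : ℝ)

/-- **The coordinate section about `x`**: `σ(y) = (F(R(‖y‖)), R(‖y‖), y₃/‖y‖, Φ_x(y) + G(R(‖y‖)))`
— the ingoing Kerr coordinates `(t*, r, μ, φ_in)` of the Boyer–Lindquist leaf point over `y`, with
the local azimuth `Φ_x` as Boyer–Lindquist azimuth. Visser arXiv:0706.0622, §5; Brandt–Seidel 1996,
§II. [cite: BrandtSeidel1996, §II] -/
def coordSection (x y : E3) : E4 :=
  !₂[heightBL M a b (qiRadius M a ‖y‖), qiRadius M a ‖y‖, y 2 / ‖y‖,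
    localAzimuth x y + twistBL M a b (qiRadius M a ‖y‖)]

/-- Component formulas. [cite: BrandtSeidel1996, §II] -/
@[simp] theorem coordSection_apply_zero (x y : E3) :
    coordSection M a b x y 0 = heightBL M a b (qiRadius M a ‖y‖) := rfl

/-- Component formulas. [cite: BrandtSeidel1996, §II] -/
@[simp] theorem coordSection_apply_one (x y : E3) : coordSection M a b x y 1 = qiRadius M a ‖y‖ := rfl

/-- Component formulas. [cite: BrandtSeidel1996, §II] -/
@[simp] theorem coordSection_apply_two (x y : E3) : coordSection M a b x y 2 = y 2 / ‖y‖ := rfl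

/-- Component formulas. [cite: BrandtSeidel1996, §II] -/
@[simp] theorem coordSection_apply_three (x y : E3) :
    coordSection M a b x y 3 = localAzimuth x y + twistBL M a b (qiRadius M a ‖y‖) := rfl

/-- The radial differential `dR_x = (q(ρ)/ρ) ⟪x, ·⟫/ρ` (`R′ = q/ρ`, chain rule with `d‖·‖`).
[cite: BrandtSeidel1996, §II] -/
def dRCLM (x : E3) : E3 →L[ℝ] ℝ :=
  (qiRoot M a ‖x‖ / ‖x‖ * ‖x‖⁻¹) • E3.covec x

/-- `dR_x(v) = (q/ρ)(⟪x, v⟫/ρ)`. [cite: BrandtSeidel1996, §II] -/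
@[simp] theorem dRCLM_apply (x v : E3) :
    dRCLM M a x v = qiRoot M a ‖x‖ / ‖x‖ * (⟪x, v⟫_ℝ / ‖x‖) := by
  simp [dRCLM, div_eq_mul_inv]; ring

/-- The latitude differential `dμ_x = ρ⁻¹ dy₃ − (x₃/ρ³) ⟪x, ·⟫`. [folklore] -/
def dMuCLM (x : E3) : E3 →L[ℝ] ℝ :=
  ‖x‖⁻¹ • (EuclideanSpace.proj (𝕜 := ℝ) (2 : Fin 3) : E3 →L[ℝ] ℝ) - (x 2 / ‖x‖ ^ 3) • E3.covec x

/-- `dμ_x(v) = dMu x v`. [folklore] -/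
@[simp] theorem dMuCLM_apply {x : E3} (hx : x ≠ 0) (v : E3) : dMuCLM x v = dMu x v := by
  have hρ : ‖x‖ ≠ 0 := norm_ne_zero_iff.2 hx
  simp [dMuCLM, dMu]
  field_simp

variable {M a b}

/-- **The differential of the coordinate section** at its base point:
`dσ_x = dR ⊗ (F′, 1, 0, G′) + dμ ⊗ ∂_μ + dφ ⊗ ∂_φ`. [cite: BrandtSeidel1996, §II] -/
def coordSectionDeriv (M a : ℝ) (x : E3) : E3 →L[ℝ] E4 :=
  (dRCLM M a x).smulRight (blLift M a (qiRadius M a ‖x‖) 1 0 0) +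
    (dMuCLM x).smulRight (E4.basisVector 2) + (dPhiCLM x).smulRight (E4.basisVector 3)

/-- **`dσ_x(v) = blLift(dR v, dμ v, dφ v)`**: the differential of the coordinate section is the
Boyer–Lindquist lift (step 1) of the slice differentials (step 2). [cite: BrandtSeidel1996, §II] -/
theorem coordSectionDeriv_apply {x : E3} (hx : x 0 ≠ 0 ∨ x 1 ≠ 0) (v : E3) :
    coordSectionDeriv M a x v =
      blLift M a (qiRadius M a ‖x‖) (qiRoot M a ‖x‖ / ‖x‖ * (⟪x, v⟫_ℝ / ‖x‖)) (dMu x v)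
        (dPhi x v) := by
  have hx0 := ne_zero_of_offAxis hx
  ext i
  fin_cases i <;>
    simp [coordSectionDeriv, blLift, dMuCLM_apply hx0, dPhi, E4.basisVector] <;> ring

/-- A map into `E4` has a Fréchet derivative iff its four components do. [folklore] -/
private theorem hasFDerivAt_e4_iff {f : E3 → E4} {f' : E3 →L[ℝ] E4} {x : E3} :
    HasFDerivAt f f' x ↔ ∀ i, HasFDerivAt (fun y ↦ f y i) ((EuclideanSpace.proj i).comp f') x := by
  rw [← hasFDerivWithinAt_univ, hasFDerivWithinAt_euclidean]
  simp only [hasFDerivWithinAt_univ]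

/-- **The coordinate section is differentiable at its base point with derivative
`coordSectionDeriv`** (`‖x‖ > ρH`, `x` off the axis, base `b > rH`): chain rules for
`F ∘ R ∘ ‖·‖`, `R ∘ ‖·‖`, `y₃/‖y‖`, `Φ_x + G ∘ R ∘ ‖·‖`. [cite: BrandtSeidel1996, §II] -/
theorem hasFDerivAt_coordSection {x : E3} (hb : rH M a < b) (hρ : rhoH M a < ‖x‖)
    (hx : x 0 ≠ 0 ∨ x 1 ≠ 0) :
    HasFDerivAt (coordSection M a b x) (coordSectionDeriv M a x) x := by
  have hx0 : x ≠ 0 := ne_zero_of_offAxis hx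
  have hρ0 : ‖x‖ ≠ 0 := norm_ne_zero_iff.2 hx0
  have hR : rH M a < qiRadius M a ‖x‖ := qiRadius_gt_rH hρ
  -- the basic differentials
  have hnorm : HasFDerivAt (fun y : E3 ↦ ‖y‖) (‖x‖⁻¹ • E3.covec x) x := hasFDerivAt_norm_E3 hx0
  have hRad : HasFDerivAt (fun y : E3 ↦ qiRadius M a ‖y‖) (dRCLM M a x) x := by
    have h := (hasDerivAt_qiRadius M a hρ0).comp_hasFDerivAt x hnorm
    refine h.congr_fderiv ?_
    rw [dRCLM, smul_smul]
  have hF : HasFDerivAt (fun y : E3 ↦ heightBL M a b (qiRadius M a ‖y‖))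
      (blSlopeT M a (qiRadius M a ‖x‖) • dRCLM M a x) x :=
    (hasDerivAt_heightBL hb hR).comp_hasFDerivAt x hRad
  have hG : HasFDerivAt (fun y : E3 ↦ twistBL M a b (qiRadius M a ‖y‖))
      (blSlopePhi M a (qiRadius M a ‖x‖) • dRCLM M a x) x :=
    (hasDerivAt_twistBL hb hR).comp_hasFDerivAt x hRad
  have hμ : HasFDerivAt (fun y : E3 ↦ y 2 / ‖y‖) (dMuCLM x) x := by
    have h2 : HasFDerivAt (fun y : E3 ↦ y 2) (EuclideanSpace.proj (𝕜 := ℝ) (2 : Fin 3)) x :=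
      (EuclideanSpace.proj (𝕜 := ℝ) (2 : Fin 3)).hasFDerivAt
    have hinv : HasFDerivAt (fun y : E3 ↦ ‖y‖⁻¹) ((-(‖x‖ ^ 2)⁻¹) • (‖x‖⁻¹ • E3.covec x)) x :=
      (hasDerivAt_inv hρ0).comp_hasFDerivAt x hnorm
    have h := h2.mul hinv
    have hfun : (fun y : E3 ↦ y 2 / ‖y‖) = fun y ↦ y 2 * ‖y‖⁻¹ := rfl
    rw [hfun]
    refine h.congr_fderiv ?_
    ext v
    rw [dMuCLM_apply hx0]
    simp [dMu, smul_eq_mul]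
    field_simp
    ring
  have hΦ : HasFDerivAt (localAzimuth x) (dPhiCLM x) x := hasFDerivAt_localAzimuth hx
  rw [hasFDerivAt_e4_iff]
  intro i
  fin_cases i
  · -- `t* = F(R(‖y‖))`
    refine hF.congr_fderiv ?_
    ext v
    simp [coordSectionDeriv, blLift, E4.basisVector, smul_eq_mul]
    ring
  · -- `r = R(‖y‖)`
    refine hRad.congr_fderiv ?_
    ext v
    simp [coordSectionDeriv, blLift, E4.basisVector]
  · -- `μ = y₃/‖y‖`
    refine hμ.congr_fderiv ?_
    ext v
    simp [coordSectionDeriv, blLift, E4.basisVector]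
  · -- `φ_in = Φ_x + G(R(‖y‖))`
    refine (hΦ.add hG).congr_fderiv ?_
    ext v
    simp [coordSectionDeriv, blLift, E4.basisVector, smul_eq_mul]
    ring

/-! ### The leaf map factors through the chart; its differential; the induced metric -/

/-- The coordinate section at its base point lies in the coordinate domain of the ingoing chart
(`R > max r₀ 0`, `−1 < x₃/ρ < 1` off the axis). [cite: arXiv07060622, §4] -/
theorem coordSection_mem_coordDomain {r₀ : ℝ} {x y : E3} (hy : y 0 ≠ 0 ∨ y 1 ≠ 0)
    (hR : max r₀ 0 < qiRadius M a ‖y‖) : coordSection M a b x y ∈ coordDomain r₀ := by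
  rw [mem_coordDomain, coordSection_apply_one, coordSection_apply_two]
  exact ⟨hR, div_norm_mem_Ioo hy⟩

/-- **Pointwise factorisation**: for `y` off the axis with `R(‖y‖) > max r₀ 0` and `c̄(x) z(y)` in
the slit plane, `Ψ(σ_x(y)) = leafRep y`. [cite: arXiv07060622, §4] -/
theorem chartFun_coordSection {r₀ : ℝ} {x y : E3} (hx : x 0 ≠ 0 ∨ x 1 ≠ 0) (hy : y 0 ≠ 0 ∨ y 1 ≠ 0)
    (hR : max r₀ 0 < qiRadius M a ‖y‖) :
    chartFun a r₀ (coordSection M a b x y) = leafRep M a b y := by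
  have hρ : 0 < ‖y‖ := norm_pos_iff.2 (ne_zero_of_offAxis hy)
  rw [chartFun_eq (coordSection_mem_coordDomain hy hR), coordSection_apply_zero,
    coordSection_apply_one, coordSection_apply_two, coordSection_apply_three, leafRep,
    ← leafSpatial_kerrStar M a b hρ, kerrStar_norm_arccos_localAzimuth hx hy]

/-- **Local factorisation**: near an off-axis `x` with `R(‖x‖) > max r₀ 0`,
`Ψ ∘ σ_x = leafRep`. [cite: arXiv07060622, §4] -/
theorem chartFun_coordSection_eventuallyEq {r₀ : ℝ} {x : E3} (hx : x 0 ≠ 0 ∨ x 1 ≠ 0)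
    (hR : max r₀ 0 < qiRadius M a ‖x‖) :
    (fun y ↦ chartFun a r₀ (coordSection M a b x y)) =ᶠ[𝓝 x] leafRep M a b := by
  -- off-axis is open, `y ↦ R(‖y‖)` is continuous at `x ≠ 0`
  have hx0 : x ≠ 0 := ne_zero_of_offAxis hx
  have h1 : ∀ᶠ y in 𝓝 x, y 0 ≠ 0 ∨ y 1 ≠ 0 := by
    have ho : IsOpen {y : E3 | y 0 ≠ 0 ∨ y 1 ≠ 0} :=
      (isOpen_ne_fun (EuclideanSpace.proj (𝕜 := ℝ) (0 : Fin 3)).continuous continuous_const).union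
        (isOpen_ne_fun (EuclideanSpace.proj (𝕜 := ℝ) (1 : Fin 3)).continuous continuous_const)
    exact ho.mem_nhds hx
  have h2 : ∀ᶠ y in 𝓝 x, max r₀ 0 < qiRadius M a ‖y‖ := by
    have hc : ContinuousAt (fun y : E3 ↦ qiRadius M a ‖y‖) x :=
      (contDiffAt_qiRadius_norm M a hx0 (n := 0)).continuousAt
    exact hc.eventually (isOpen_Ioi.mem_nhds hR)
  filter_upwards [h1, h2] with y hy hRy
  exact chartFun_coordSection hx hy hRy

/-- **The differential of the leaf map at an off-axis point is `J ∘ dσ`**: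
`d(leafRep)_x = J_{σ x} ∘ coordSectionDeriv x` (`‖x‖ > ρH`, `R(‖x‖) > max r₀ 0`, base `b > rH`).
[cite: arXiv07060622, §4] -/
theorem hasFDerivAt_leafRep {r₀ : ℝ} {x : E3} (hb : rH M a < b) (hρ : rhoH M a < ‖x‖)
    (hx : x 0 ≠ 0 ∨ x 1 ≠ 0) (hR : max r₀ 0 < qiRadius M a ‖x‖) :
    HasFDerivAt (leafRep M a b) ((jac a (coordSection M a b x x)).comp (coordSectionDeriv M a x)) x :=
  ((hasFDerivAt_chartFun (coordSection_mem_coordDomain hx hR)).comp x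
    (hasFDerivAt_coordSection hb hρ hx)).congr_of_eventuallyEq
      (chartFun_coordSection_eventuallyEq hx hR).symm

/-- **The induced metric of the leaf map at an off-axis point is `blHRep`**:
`g_{leafRep x}(d leafRep v, d leafRep w) = (Σ/ρ²)⟪v, w⟫ + (a²(Σ + 2MR)/Σ) ϖ(v)ϖ(w)` — the
Boyer–Lindquist slice metric in quasi-isotropic Cartesian coordinates (`kerrBilin_jac` +
`bilin_blLift_quasiIsotropic`). Brandt–Seidel 1996, §II; Boyer–Lindquist 1967, (2.13).
[cite: BrandtSeidel1996, §II] -/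
theorem bilin_fderiv_leafRep {r₀ : ℝ} {x : E3} (hb : rH M a < b) (hρ : rhoH M a < ‖x‖)
    (hx : x 0 ≠ 0 ∨ x 1 ≠ 0) (hR : max r₀ 0 < qiRadius M a ‖x‖) (v w : E3) :
    Kerr.bilin M a (leafRep M a b x) (fderiv ℝ (leafRep M a b) x v) (fderiv ℝ (leafRep M a b) x w) =
      blHRep M a x v w := by
  have hmem := coordSection_mem_coordDomain (M := M) (a := a) (b := b) (x := x) hx hR
  rw [(hasFDerivAt_leafRep hb hρ hx hR).fderiv, ← chartFun_coordSection hx hx hR]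
  simp only [ContinuousLinearMap.comp_apply]
  rw [kerrBilin_jac hmem, coordSectionDeriv_apply hx, coordSectionDeriv_apply hx]
  have hu1 : coordSection M a b x x 1 = qiRadius M a ‖x‖ := rfl
  rw [show qiRadius M a ‖x‖ = coordSection M a b x x 1 from rfl]
  exact bilin_blLift_quasiIsotropic (sq_add_sq_ne_zero_of_offAxis hx) hu1 rfl
    (sigma_ne_zero hmem) (qiRoot_pos_of_rhoH_lt hρ).ne' v w

end Kerr.BL

end Literature.Geometry.Lorentzian

end
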